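import Summits.QuantumFields.YangMills.Theorems.ToronValleyVolumePeriodicRingCeilingBox
import Summits.QuantumFields.YangMills.Theorems.SwapVirialDeficitSwapRingDeficit
import Summits.QuantumFields.YangMills.Theorems.SwapTwistDeficitPeriodicRingFloorToronBox
import HarnessLib

/-!
# The fixed-`L` CEILING of the σ-glued ring, Ia: bond bounds from the sums form and the tree-gauge consequences shared with the periodic ring
# (free-hands support of item stmt-QuantumFields-24197 `SwapVirialDeficit.SwapGluedStiffness`; brick (β-i) of LEAD ym-line-sfw-p2 g93's 05:57Z programme
# «(β) the log-free swap CEILING `μ^S{F^S ≤ t} ≤ C_L t^{9L⁴−1}`», by the tree-gauge rigidity route of seat fcl-p3 g43's periodic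
# ✓`PeriodicRingCeiling.commBox_of_ringDeficit` instead of a Łojasiewicz inequality)

For a `2L`-slice ring history `P = (U⃗, g)` and every seam sector `z`, with `δ = √F^S_z(P)`, `F^S_z = swapRingDeficit L z` (the σ-glued seam couples the
last slice to `g · τ_z(σ·U_0)`, `σ = (0 1)` the swap of the spatial axes `0, 1`):
* §1 the sums form ✓`swapRingDeficit_eq_sums` bounds every kinetic bond (`kinetic_le_swapRingDeficit`), the σ-seam bond (`swapSeam_le_swapRingDeficit`) and
  the slice-`0` action (`wilsonAction_first_le_swapRingDeficit`) by the deficit; hence consecutive slices are `2δ`-close per link (`fd_step_le_swap`), every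
  slice is within `4Lδ` of slice `0` (`fd_slice_zero_le_swap'`), the σ-seam image `g·τ_z(σ U_0)` is within `4Lδ` of `U_0` per link (★ `fd_swapSeam_le`), and
  `√(2S(U_0)) ≤ 2δ` (`sqrt_two_action_le_swap`);
* §2 in tree gauge `P = (glue w ∷ r, g)`: slices `4Lδ` (`swap_slices_near`), letters `12L²δ` (`swap_letters_near`, lane A's comb ✓`fd_treeFix_combFlat_le`),
  wrap links pairwise commuting up to `20L²δ` (`swap_wraps_comm`, ✓`fd_comm_wrapReps_le`) — verbatim the periodic arguments of ✓`PeriodicRingCeilingBox`.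
The σ-SEAM (sector `0`) and the box theorem are in the sequel `SwapVirialDeficitSwapRingCeilingBox`.
HONEST LABEL: deterministic Frobenius-norm estimates on a fixed lattice; ⟨24197⟩, ⟨24194⟩, ⟨24497⟩, ⟨24196⟩ stay OPEN; no crux, rung or summit is proved;
the Yang–Mills mass gap is NOT proved; no summit is proved by a line.  THEOREMS ONLY (0 `def`, 0 `sorry`), standard axioms.  Width seat ym-line-sfw-p2-w3 g61
(cell ym-idea-1, free hands), `--supports stmt-QuantumFields-24197`.  References: [cite: tHooft1979]; [cite: Luscher1983, §2]; [cite: GonzalezarroyoAltes1988]; [folklore].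
-/

set_option autoImplicit false

noncomputable section

open scoped Quaternion Matrix BigOperators Matrix.Norms.Frobenius
open Literature.MathematicalPhysics.QuantumFieldTheory hiding SU2
open Literature.MathematicalPhysics.QuantumLattice

namespace Summit.QuantumFields.YangMills.Theorems.SwapVirialDeficit.SwapRing

open Summit.QuantumFields.YangMills.Theorems.FemtoTransferGap
open Summit.QuantumFields.YangMills.Theorems.FemtoTransferGap.TT
open Summit.QuantumFields.YangMills.Theorems.FemtoTransferGap.TwoLattice
open Summit.QuantumFields.YangMills.Theorems.FemtoTransferGap.TwoLattice.Flat
open Summit.QuantumFields.YangMills.Theorems.FemtoTransferGap.TwoLattice.Cov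
open Summit.QuantumFields.YangMills.Theorems.VirialFluxGap.RingDeficit
open Summit.QuantumFields.YangMills.Theorems.ToronValleyVolume.Lojasiewicz
open Summit.QuantumFields.YangMills.Theorems.ToronValleyVolume.PeriodicRingCeiling
  (wrapReps_glue fd_one_eq frobNorm_comm_eq_fd frobNorm_inv_mul_sub_one_eq_fd mk3_wrap_eq_single)
open Summit.QuantumFields.YangMills.Theorems.SwapTwistDeficit.PeriodicRingFloor

variable {L : ℕ} [NeZero L]

/-! ## §1 The sums form: every bond is controlled by the deficit (every sector `z`) -/

/-- Each kinetic bond deficit is at most the swap deficit. [folklore] -/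
theorem kinetic_le_swapRingDeficit (z : Fin 3 → Bool) (P : (Fin (2 * L - 1 + 1) → GaugeConfig 3 L SU2) × (Site 3 L → SU2))
    (i : Fin (2 * L - 1)) :
    6 * (L : ℝ) ^ 3 - timeCoupling su2Rep (P.1 i.castSucc) (P.1 i.succ) ≤ swapRingDeficit L z P := by
  rw [swapRingDeficit_eq_sums]
  have hA : 6 * (L : ℝ) ^ 3 - timeCoupling su2Rep (P.1 i.castSucc) (P.1 i.succ) ≤
      ∑ i : Fin (2 * L - 1), (6 * (L : ℝ) ^ 3 - timeCoupling su2Rep (P.1 i.castSucc) (P.1 i.succ)) :=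
    Finset.single_le_sum (f := fun i : Fin (2 * L - 1) => 6 * (L : ℝ) ^ 3 - timeCoupling su2Rep (P.1 i.castSucc) (P.1 i.succ))
      (fun j _ => by linarith [timeCoupling_su2Rep_le (P.1 j.castSucc) (P.1 j.succ)]) (Finset.mem_univ i)
  have hB : 0 ≤ 6 * (L : ℝ) ^ 3 - timeCoupling su2Rep (P.1 (Fin.last (2 * L - 1)))
      (gaugeTransform P.2 (twist3 z (configPerm (Equiv.swap (0 : Fin 3) 1) (P.1 0)))) := by
    linarith [timeCoupling_su2Rep_le (P.1 (Fin.last (2 * L - 1))) (gaugeTransform P.2 (twist3 z (configPerm (Equiv.swap (0 : Fin 3) 1) (P.1 0))))]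
  have hC : 0 ≤ ∑ i : Fin (2 * L - 1), (1 / 2 : ℝ) * (wilsonAction su2Rep (P.1 i.castSucc) + wilsonAction su2Rep (P.1 i.succ)) :=
    Finset.sum_nonneg fun j _ => by linarith [wilsonAction_su2_nonneg_lat (P.1 j.castSucc), wilsonAction_su2_nonneg_lat (P.1 j.succ)]
  have hD : 0 ≤ (1 / 2 : ℝ) * (wilsonAction su2Rep (P.1 (Fin.last (2 * L - 1))) +
      wilsonAction su2Rep (gaugeTransform P.2 (twist3 z (configPerm (Equiv.swap (0 : Fin 3) 1) (P.1 0))))) := by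
    linarith [wilsonAction_su2_nonneg_lat (P.1 (Fin.last (2 * L - 1))),
      wilsonAction_su2_nonneg_lat (gaugeTransform P.2 (twist3 z (configPerm (Equiv.swap (0 : Fin 3) 1) (P.1 0))))]
  linarith

/-- The σ-glued seam bond deficit is at most the swap deficit. [folklore] -/
theorem swapSeam_le_swapRingDeficit (z : Fin 3 → Bool) (P : (Fin (2 * L - 1 + 1) → GaugeConfig 3 L SU2) × (Site 3 L → SU2)) :
    6 * (L : ℝ) ^ 3 - timeCoupling su2Rep (P.1 (Fin.last (2 * L - 1)))
        (gaugeTransform P.2 (twist3 z (configPerm (Equiv.swap (0 : Fin 3) 1) (P.1 0)))) ≤ swapRingDeficit L z P := by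
  rw [swapRingDeficit_eq_sums]
  have hA : 0 ≤ ∑ i : Fin (2 * L - 1), (6 * (L : ℝ) ^ 3 - timeCoupling su2Rep (P.1 i.castSucc) (P.1 i.succ)) :=
    Finset.sum_nonneg fun j _ => by linarith [timeCoupling_su2Rep_le (P.1 j.castSucc) (P.1 j.succ)]
  have hC : 0 ≤ ∑ i : Fin (2 * L - 1), (1 / 2 : ℝ) * (wilsonAction su2Rep (P.1 i.castSucc) + wilsonAction su2Rep (P.1 i.succ)) :=
    Finset.sum_nonneg fun j _ => by linarith [wilsonAction_su2_nonneg_lat (P.1 j.castSucc), wilsonAction_su2_nonneg_lat (P.1 j.succ)]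
  have hD : 0 ≤ (1 / 2 : ℝ) * (wilsonAction su2Rep (P.1 (Fin.last (2 * L - 1))) +
      wilsonAction su2Rep (gaugeTransform P.2 (twist3 z (configPerm (Equiv.swap (0 : Fin 3) 1) (P.1 0))))) := by
    linarith [wilsonAction_su2_nonneg_lat (P.1 (Fin.last (2 * L - 1))),
      wilsonAction_su2_nonneg_lat (gaugeTransform P.2 (twist3 z (configPerm (Equiv.swap (0 : Fin 3) 1) (P.1 0))))]
  linarith

/-- The spatial action of slice `0` is at most twice the swap deficit (the `i = 0` magnetic bond already carries `½S(U_0)`). [folklore] -/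
theorem wilsonAction_first_le_swapRingDeficit (z : Fin 3 → Bool) (P : (Fin (2 * L - 1 + 1) → GaugeConfig 3 L SU2) × (Site 3 L → SU2)) :
    wilsonAction su2Rep (P.1 0) ≤ 2 * swapRingDeficit L z P := by
  rw [swapRingDeficit_eq_sums]
  have hL1 : 1 ≤ L := NeZero.one_le
  have h0 : 0 < 2 * L - 1 := by omega
  set i₀ : Fin (2 * L - 1) := ⟨0, h0⟩ with hi₀
  have hcast : P.1 i₀.castSucc = P.1 0 := by rw [hi₀]; rfl
  have hA : 0 ≤ ∑ i : Fin (2 * L - 1), (6 * (L : ℝ) ^ 3 - timeCoupling su2Rep (P.1 i.castSucc) (P.1 i.succ)) :=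
    Finset.sum_nonneg fun j _ => by linarith [timeCoupling_su2Rep_le (P.1 j.castSucc) (P.1 j.succ)]
  have hB : 0 ≤ 6 * (L : ℝ) ^ 3 - timeCoupling su2Rep (P.1 (Fin.last (2 * L - 1)))
      (gaugeTransform P.2 (twist3 z (configPerm (Equiv.swap (0 : Fin 3) 1) (P.1 0)))) := by
    linarith [timeCoupling_su2Rep_le (P.1 (Fin.last (2 * L - 1))) (gaugeTransform P.2 (twist3 z (configPerm (Equiv.swap (0 : Fin 3) 1) (P.1 0))))]
  have hC : (1 / 2 : ℝ) * (wilsonAction su2Rep (P.1 i₀.castSucc) + wilsonAction su2Rep (P.1 i₀.succ)) ≤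
      ∑ i : Fin (2 * L - 1), (1 / 2 : ℝ) * (wilsonAction su2Rep (P.1 i.castSucc) + wilsonAction su2Rep (P.1 i.succ)) :=
    Finset.single_le_sum (f := fun i : Fin (2 * L - 1) => (1 / 2 : ℝ) * (wilsonAction su2Rep (P.1 i.castSucc) + wilsonAction su2Rep (P.1 i.succ)))
      (fun j _ => by linarith [wilsonAction_su2_nonneg_lat (P.1 j.castSucc), wilsonAction_su2_nonneg_lat (P.1 j.succ)]) (Finset.mem_univ i₀)
  rw [hcast] at hC
  have hC1 : 0 ≤ wilsonAction su2Rep (P.1 i₀.succ) := wilsonAction_su2_nonneg_lat _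
  have hD : 0 ≤ (1 / 2 : ℝ) * (wilsonAction su2Rep (P.1 (Fin.last (2 * L - 1))) +
      wilsonAction su2Rep (gaugeTransform P.2 (twist3 z (configPerm (Equiv.swap (0 : Fin 3) 1) (P.1 0))))) := by
    linarith [wilsonAction_su2_nonneg_lat (P.1 (Fin.last (2 * L - 1))),
      wilsonAction_su2_nonneg_lat (gaugeTransform P.2 (twist3 z (configPerm (Equiv.swap (0 : Fin 3) 1) (P.1 0))))]
  linarith

/-- Consecutive slices are `2√F^S`-close on every link. [folklore] -/
theorem fd_step_le_swap (z : Fin 3 → Bool) (P : (Fin (2 * L - 1 + 1) → GaugeConfig 3 L SU2) × (Site 3 L → SU2))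
    (i : Fin (2 * L - 1)) (e : Edge 3 L) :
    fd (P.1 i.castSucc e) (P.1 i.succ e) ≤ 2 * Real.sqrt (swapRingDeficit L z P) := by
  have h1 := norm_sq_le_timeCoupling_deficit (P.1 i.castSucc) (P.1 i.succ) e
  have h2 := kinetic_le_swapRingDeficit z P i
  have h3 : ‖su2Quat (P.1 i.castSucc e) - su2Quat (P.1 i.succ e)‖ ≤ Real.sqrt (swapRingDeficit L z P) :=
    Real.le_sqrt_of_sq_le (by linarith)
  linarith [fd_le_two_mul_norm_su2Quat_sub (P.1 i.castSucc e) (P.1 i.succ e)]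

/-- Every slice is within `k·2√F^S` of slice `0` on every link (`k` = its index). [folklore] -/
theorem fd_slice_zero_le_swap (z : Fin 3 → Bool) (P : (Fin (2 * L - 1 + 1) → GaugeConfig 3 L SU2) × (Site 3 L → SU2)) (e : Edge 3 L) :
    ∀ (k : ℕ) (hk : k < 2 * L - 1 + 1), fd (P.1 ⟨k, hk⟩ e) (P.1 0 e) ≤ k * (2 * Real.sqrt (swapRingDeficit L z P)) := by
  intro k
  induction k with
  | zero => intro hk; simp [show (⟨0, hk⟩ : Fin (2 * L - 1 + 1)) = 0 from rfl, fd_self]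
  | succ k ih =>
    intro hk
    have hk' : k < 2 * L - 1 := by omega
    have hs := fd_step_le_swap z P ⟨k, hk'⟩ e
    have e1 : (⟨k, hk'⟩ : Fin (2 * L - 1)).castSucc = ⟨k, by omega⟩ := rfl
    have e2 : (⟨k, hk'⟩ : Fin (2 * L - 1)).succ = ⟨k + 1, hk⟩ := rfl
    rw [e1, e2] at hs
    have := ih (by omega)
    rw [fd_comm] at hs
    push_cast
    linarith [fd_triangle (P.1 ⟨k + 1, hk⟩ e) (P.1 ⟨k, by omega⟩ e) (P.1 0 e)]

/-- Every slice is within `4L√F^S` of slice `0` on every link. [folklore] -/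
theorem fd_slice_zero_le_swap' (z : Fin 3 → Bool) (P : (Fin (2 * L - 1 + 1) → GaugeConfig 3 L SU2) × (Site 3 L → SU2))
    (i : Fin (2 * L - 1 + 1)) (e : Edge 3 L) :
    fd (P.1 i e) (P.1 0 e) ≤ 4 * (L : ℝ) * Real.sqrt (swapRingDeficit L z P) := by
  have h := fd_slice_zero_le_swap z P e i.val i.isLt
  have hi : (i.val : ℝ) ≤ 2 * (L : ℝ) := by
    have : i.val ≤ 2 * L := by omega
    exact_mod_cast this
  have hs := Real.sqrt_nonneg (swapRingDeficit L z P)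
  calc fd (P.1 i e) (P.1 0 e) = fd (P.1 ⟨i.val, i.isLt⟩ e) (P.1 0 e) := rfl
    _ ≤ i.val * (2 * Real.sqrt (swapRingDeficit L z P)) := h
    _ ≤ 2 * (L : ℝ) * (2 * Real.sqrt (swapRingDeficit L z P)) := mul_le_mul_of_nonneg_right hi (by positivity)
    _ = 4 * (L : ℝ) * Real.sqrt (swapRingDeficit L z P) := by ring

/-- **The σ-glued seam moves slice `0` by at most `4L√F^S` on every link**: `fd(U_0(e), (g·τ_z(σU_0))(e)) ≤ 4L√F^S_z`. [cite: tHooft1979] [folklore] -/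
theorem fd_swapSeam_le (z : Fin 3 → Bool) (P : (Fin (2 * L - 1 + 1) → GaugeConfig 3 L SU2) × (Site 3 L → SU2)) (e : Edge 3 L) :
    fd (P.1 0 e) (gaugeTransform P.2 (twist3 z (configPerm (Equiv.swap (0 : Fin 3) 1) (P.1 0))) e) ≤
      4 * (L : ℝ) * Real.sqrt (swapRingDeficit L z P) := by
  set V := gaugeTransform P.2 (twist3 z (configPerm (Equiv.swap (0 : Fin 3) 1) (P.1 0))) with hV
  set r := Real.sqrt (swapRingDeficit L z P) with hr
  have hs : 0 ≤ r := Real.sqrt_nonneg _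
  -- last slice vs seam image
  have h1 := norm_sq_le_timeCoupling_deficit (P.1 (Fin.last (2 * L - 1))) V e
  have h2 := swapSeam_le_swapRingDeficit z P
  have h3 : ‖su2Quat (P.1 (Fin.last (2 * L - 1)) e) - su2Quat (V e)‖ ≤ r := Real.le_sqrt_of_sq_le (by linarith)
  have h4 : fd (P.1 (Fin.last (2 * L - 1)) e) (V e) ≤ 2 * r := by
    linarith [fd_le_two_mul_norm_su2Quat_sub (P.1 (Fin.last (2 * L - 1)) e) (V e)]
  -- last slice vs slice 0
  have h5 := fd_slice_zero_le_swap z P e (2 * L - 1) (by omega)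
  have e5 : (⟨2 * L - 1, by omega⟩ : Fin (2 * L - 1 + 1)) = Fin.last (2 * L - 1) := rfl
  rw [e5] at h5
  have hL1 : 1 ≤ L := NeZero.one_le
  have hN : (((2 * L - 1 : ℕ) : ℝ)) = 2 * (L : ℝ) - 1 := by
    rw [Nat.cast_sub (by omega), Nat.cast_mul]; push_cast; ring
  rw [hN] at h5
  rw [fd_comm] at h5
  calc fd (P.1 0 e) (V e) ≤ fd (P.1 0 e) (P.1 (Fin.last (2 * L - 1)) e) + fd (P.1 (Fin.last (2 * L - 1)) e) (V e) := fd_triangle _ _ _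
    _ ≤ (2 * (L : ℝ) - 1) * (2 * r) + 2 * r := add_le_add h5 h4
    _ = 4 * (L : ℝ) * r := by ring

/-- `√(2S(U_0)) ≤ 2√F^S`. [folklore] -/
theorem sqrt_two_action_le_swap (z : Fin 3 → Bool) (P : (Fin (2 * L - 1 + 1) → GaugeConfig 3 L SU2) × (Site 3 L → SU2)) :
    Real.sqrt (2 * wilsonAction su2Rep (P.1 0)) ≤ 2 * Real.sqrt (swapRingDeficit L z P) := by
  have h := wilsonAction_first_le_swapRingDeficit z P
  have h4 : 2 * wilsonAction su2Rep (P.1 0) ≤ 2 ^ 2 * swapRingDeficit L z P := by linarith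
  calc Real.sqrt (2 * wilsonAction su2Rep (P.1 0)) ≤ Real.sqrt (2 ^ 2 * swapRingDeficit L z P) := Real.sqrt_le_sqrt h4
    _ = 2 * Real.sqrt (swapRingDeficit L z P) := by rw [Real.sqrt_mul (by norm_num), Real.sqrt_sq (by norm_num)]

/-! ## §2 In tree gauge: slices, letters and wrap links (every sector `z`) -/

/-- Slices: every link of slice `j + 1` is within `4L·√F^S` of the corresponding link of slice `0`. [cite: Luscher1983, §2] -/
theorem swap_slices_near (z : Fin 3 → Bool) (w : OffIdx L → SU2) (r : Fin (2 * L - 1) → GaugeConfig 3 L SU2) (g : Site 3 L → SU2)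
    (j : Fin (2 * L - 1)) (e : Edge 3 L) :
    frobNorm ((((glue w e)⁻¹ * r j e : SU2) : Matrix (Fin 2) (Fin 2) ℂ) - 1) ≤
      4 * (L : ℝ) * Real.sqrt (swapRingDeficit L z ((Fin.cons (glue w) r : Fin (2 * L - 1 + 1) → GaugeConfig 3 L SU2), g)) := by
  rw [frobNorm_inv_mul_sub_one_eq_fd]
  have h := fd_slice_zero_le_swap' z ((Fin.cons (glue w) r : Fin (2 * L - 1 + 1) → GaugeConfig 3 L SU2), g) j.succ e
  simpa only [Fin.cons_succ, Fin.cons_zero] using h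

/-- Letters: every off-tree link of slice `0` is within `12L²·√F^S` of its letter. [cite: Luscher1983, §2] -/
theorem swap_letters_near (z : Fin 3 → Bool) (w : OffIdx L → SU2) (r : Fin (2 * L - 1) → GaugeConfig 3 L SU2) (g : Site 3 L → SU2)
    (i : OffIdx L) :
    frobNorm ((((if i.1.1 i.1.2 = -1 then w ⟨(Pi.single i.1.2 (-1 : ZMod L), i.1.2), leader_not_treeEdge i.1.2⟩ else 1)⁻¹ * w i : SU2) :
        Matrix (Fin 2) (Fin 2) ℂ) - 1) ≤
      12 * (L : ℝ) ^ 2 * Real.sqrt (swapRingDeficit L z ((Fin.cons (glue w) r : Fin (2 * L - 1 + 1) → GaugeConfig 3 L SU2), g)) := by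
  set P : (Fin (2 * L - 1 + 1) → GaugeConfig 3 L SU2) × (Site 3 L → SU2) := (Fin.cons (glue w) r, g) with hP
  set δ := Real.sqrt (swapRingDeficit L z P) with hδ
  have hδ0 : 0 ≤ δ := Real.sqrt_nonneg _
  have hL1 : (1 : ℝ) ≤ L := by exact_mod_cast NeZero.one_le
  have hL0 : (0 : ℝ) ≤ (L : ℝ) - 1 := by linarith
  have hS : Real.sqrt (2 * wilsonAction su2Rep (glue w)) ≤ 2 * δ := by
    have h := sqrt_two_action_le_swap z P
    have hP1 : P.1 0 = glue w := rfl
    rwa [hP1] at h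
  rw [frobNorm_inv_mul_sub_one_eq_fd]
  have h := fd_treeFix_combFlat_le (glue w) i.1
  rw [treeFix_glue, combFlat_apply, glue_apply_of_not_tree w i.2] at h
  have hletter : (if i.1.1 i.1.2 = -1 then wrapReps (glue w) i.1.2 else 1) =
      (if i.1.1 i.1.2 = -1 then w ⟨(Pi.single i.1.2 (-1 : ZMod L), i.1.2), leader_not_treeEdge i.1.2⟩ else 1) := by
    rw [wrapReps_glue]
  rw [hletter] at h
  calc fd (w i) _ ≤ ((L : ℝ) - 1) * ((6 * (L : ℝ) - 4) * Real.sqrt (2 * wilsonAction su2Rep (glue w))) := h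
    _ ≤ ((L : ℝ) - 1) * ((6 * (L : ℝ) - 4) * (2 * δ)) :=
        mul_le_mul_of_nonneg_left (mul_le_mul_of_nonneg_left hS (by linarith)) hL0
    _ ≤ 12 * (L : ℝ) ^ 2 * δ := by nlinarith

/-- Leaders: the wrap links pairwise commute up to `20L²·√F^S` (Frobenius). [cite: Luscher1983, §2] -/
theorem swap_wraps_comm (z : Fin 3 → Bool) (w : OffIdx L → SU2) (r : Fin (2 * L - 1) → GaugeConfig 3 L SU2) (g : Site 3 L → SU2)
    (μ ν : Fin 3) :
    frobNorm (((w ⟨(Pi.single μ (-1 : ZMod L), μ), leader_not_treeEdge μ⟩ * w ⟨(Pi.single ν (-1 : ZMod L), ν), leader_not_treeEdge ν⟩ : SU2) :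
          Matrix (Fin 2) (Fin 2) ℂ) -
        ((w ⟨(Pi.single ν (-1 : ZMod L), ν), leader_not_treeEdge ν⟩ * w ⟨(Pi.single μ (-1 : ZMod L), μ), leader_not_treeEdge μ⟩ : SU2) :
          Matrix (Fin 2) (Fin 2) ℂ)) ≤
      20 * (L : ℝ) ^ 2 * Real.sqrt (swapRingDeficit L z ((Fin.cons (glue w) r : Fin (2 * L - 1 + 1) → GaugeConfig 3 L SU2), g)) := by
  set P : (Fin (2 * L - 1 + 1) → GaugeConfig 3 L SU2) × (Site 3 L → SU2) := (Fin.cons (glue w) r, g) with hP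
  set δ := Real.sqrt (swapRingDeficit L z P) with hδ
  have hδ0 : 0 ≤ δ := Real.sqrt_nonneg _
  have hL1 : (1 : ℝ) ≤ L := by exact_mod_cast NeZero.one_le
  have hS : Real.sqrt (2 * wilsonAction su2Rep (glue w)) ≤ 2 * δ := by
    have h := sqrt_two_action_le_swap z P
    have hP1 : P.1 0 = glue w := rfl
    rwa [hP1] at h
  rw [frobNorm_comm_eq_fd, ← wrapReps_glue w μ, ← wrapReps_glue w ν]
  have hC : combC L ≤ 10 * (L : ℝ) ^ 2 := by unfold combC; nlinarith
  have hC0 : 0 ≤ combC L := le_trans zero_le_one one_le_combC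
  calc fd (wrapReps (glue w) μ * wrapReps (glue w) ν * (wrapReps (glue w) μ)⁻¹ * (wrapReps (glue w) ν)⁻¹) 1
      ≤ combC L * Real.sqrt (2 * wilsonAction su2Rep (glue w)) := fd_comm_wrapReps_le (glue w) μ ν
    _ ≤ combC L * (2 * δ) := mul_le_mul_of_nonneg_left hS hC0
    _ ≤ 10 * (L : ℝ) ^ 2 * (2 * δ) := mul_le_mul_of_nonneg_right hC (by positivity)
    _ = 20 * (L : ℝ) ^ 2 * δ := by ring

end Summit.QuantumFields.YangMills.Theorems.SwapVirialDeficit.SwapRing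

end
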